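import Summits.Ventures.Crystal3D.Theorems.StickyWulffConstantGenericWallFloorEndBallClassDefs
import HarnessLib

/-!
# §51 interface — OPERATIONS on end-ball classes (definitions): add an occupied site («occupied ⇒ C′»), and the A₂ FRAME RULE
# `q ↦ q − (2(q⬝c)/3)·c` (crux `GenericWallFloor`, stmt-Ventures-19480, line `WallLedgerG`; cf-p1 2026-08-28T21:40Z)

HONEST FRAMING. Venture `Summits/Ventures/Crystal3D` (cell `crystal3d-full`), helper vocabulary for the crux `GenericWallFloor` of
`route-Ventures-StickyWulffConstant`, REGISTERED line `WallLedgerG`, open stub `stub_twoSlabAdhesion`.  DEFINITIONS ONLY (computable);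
the lemmas (`freeSites` monotonicity under `addOwn`, the reflection isometry realising `reflectQ3` on `pointVec`, carrier transfer) are the
sequel `…GenericWallFloorEndBallClassOps`.  Nothing is claimed about packings; F-C1 not moved.

* `EndBallClass.addOwn C q` — the class `C′ = (contacts, own ++ [q])`: the row verdict «site `q` occupied ⇒ class `C′`» (recursion step).
* `reflectQ3 c q := q − (2·(q ⬝ cubeInt c / 3)) • cubeInt c` — the INTEGER REFLECTION across the `{111}` plane with normal `cubeInt c`
  (meaningful when `3 ∣ q ⬝ cubeInt c`, which holds for all CSL-compatible data of a Σ3 pair: both lattices `T` and `A₂ = R_c T` consist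
  of such triples); it realises the reflection isometry on `pointVec` (…EndBallClassOps, `reflection_pointVec`).
* `EndBallClass.reflect C c` — the class with all data reflected: the A₂-FRAME PRESENTATION of a class given in T-coordinates (its
  contacts become slots `3 • slotInt i` when the class is anchored in the twin lattice; checked per class by `wf`, `decide`).
WHAT THIS IS NOT: no class data; F-C1 not moved.
-/

namespace Summit.Ventures.Crystal3D.Theorems

open Summit.Ventures.Crystal3D Finset NearIdentity

/-- **«occupied ⇒ C′»**: the class with one more certified (own) ball at the site `q`. -/
def EndBallClass.addOwn (C : EndBallClass) (q : Fin 3 → ℤ) : EndBallClass := ⟨C.contacts, C.own ++ [q]⟩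

/-- **The integer reflection** across the `{111}` plane normal to `cubeInt c`: `q ↦ q − 2·((q ⬝ c)/3)·c` (integer division; exact when
`3 ∣ q ⬝ c`). -/
def reflectQ3 (c : Fin 8) (q : Fin 3 → ℤ) : Fin 3 → ℤ := q - (2 * (sdot3 q (cubeInt c) / 3)) • cubeInt c

/-- The reflected class (A₂-frame presentation of T-frame data, or back). -/
def EndBallClass.reflect (C : EndBallClass) (c : Fin 8) : EndBallClass :=
  ⟨C.contacts.map (reflectQ3 c), C.own.map (reflectQ3 c)⟩

end Summit.Ventures.Crystal3D.Theorems
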